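import Literature.RingTheory.KTheory.AdamsOperations
import HarnessLib

/-!
# Adams operations II: multiplicativity, line elements, `ψ² ≡ x²`, and `ψ² ψ³ = ψ³ ψ²`

Continuation of `AdamsOperations.lean` (Atiyah, "Power operations in `K`-theory", §2), for a
commutative `ℂ`-algebra `R` and `k = 2, 3`. All proved:

* §12–13 **multiplicativity**: the cyclic parts of a Kronecker product,
  `[V_j(P ⊗ Q)] = ∑_{a+b ≡ j} [V_a(P)][V_b(Q)]` (`part_kronecker`, by decomposing along the
  joint eigen-idempotents `E_a ⊗ E_b`), hence `ψ^k[P ⊗ Q] = ψ^k[P] ψ^k[Q]`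
  (`psiM_kronecker`; for `k = 3` this uses `[V_1] = [V_2]`);
* §14 `psi_mul`, `psi_one` (`1` is a line element), the ring endomorphism
  **`psiRingHom R k : KZero R →+* KZero R`**, `psi_kc_of_isLine : ψ^k[L] = [L]^k`,
  `kc_sq_eq_part_add_part : [M]² = [V_0] + [V_1]` (`k = 2`) and
  **`exists_psi_two_sub_sq : ψ²(x) - x² ∈ 2 K₀(R)`** (Atiyah Prop. 2.5 for `p = 2`),
  naturality `map_psi`;
* §15–17 **`psi_two_psi_three : ψ²(ψ³ x) = ψ³(ψ² x)`**: with the joint classes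
  `Hcls kk l e m M = [E_e(β) E_m(δ) M^{⊗ kk l}]` of the commuting outer rotation `β` (order
  `kk`) and simultaneous inner rotation `δ` (order `l`), the phase lemma gives
  `H(kk,l;0,m) - H(kk,l;1,m) = ∑_{l ∣ kk c - m} ψ^kk[X_c]` (`Hcls_zero_sub_one`), so that
  `ψ²ψ³[M]` and `ψ³ψ²[M]` are alternating sums of `H(2,3;·,·)` resp. `H(3,2;·,·)`; the flip of
  the double slot structure gives `H(kk,l;e,m) = H(l,kk;m,e)` (`Hcls_flip`) and the reflections
  give `H(kk,l;e,m) = H(kk,l;-e,m) = H(kk,l;e,-m)`, whence equality (both sides are Atiyah's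
  `ψ⁶[M]`).

No named facts are introduced.

## References

* M. F. Atiyah, Power operations in `K`-theory, Quart. J. Math. Oxford (2) 17 (1966) 165–193,
  §2 (multiplicativity of `ψ^k` from `(E ⊗ F)^{⊗k} ≅ E^{⊗k} ⊗ F^{⊗k}`; Prop. 2.3, 2.5, (2.7));
  §1 Cor. 1.8 (`ψ^k ψ^l = ψ^{kl}`). [Atiyah1966PowerOperations]
* J. F. Adams, M. F. Atiyah, `K`-theory and the Hopf invariant, Quart. J. Math. Oxford (2) 17
  (1966) 31–38 (the properties of `ψ², ψ³` used there: additive, multiplicative on line bundles,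
  `ψ² ≡ x²`, `ψ²ψ³ = ψ³ψ²`). [AdamsAtiyah1966]

## Design notes

* The commutation is proved directly from the joint eigen-decomposition rather than through a
  third operation `ψ⁶`, so no eigen-theory for composite order is needed.
-/

noncomputable section

namespace Literature.RingTheory.KTheory

open Matrix Finset Kronecker

universe u

variable {R : Type u} [CommRing R]








/-! ### 12. Kronecker products of slot data -/

section KronSlots

variable {ι κ : Type*} [Fintype ι] [DecidableEq ι] [Fintype κ] [DecidableEq κ] {k : ℕ}

omit [Fintype ι] [DecidableEq ι] [Fintype κ] [DecidableEq κ] in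
/-- Adams operations via cyclic power operations (Atiyah 1966 §2). [folklore] -/
theorem sum_kronecker {α β γ δ τ : Type*} (s : Finset τ) (A : τ → Matrix α β R) (B : Matrix γ δ R) :
    (∑ t ∈ s, A t) ⊗ₖ B = ∑ t ∈ s, A t ⊗ₖ B := by
  ext ⟨i₁, i₂⟩ ⟨j₁, j₂⟩
  simp [kroneckerMap_apply, Matrix.sum_apply, Finset.sum_mul]

omit [Fintype ι] [DecidableEq ι] [Fintype κ] [DecidableEq κ] in
/-- Adams operations via cyclic power operations (Atiyah 1966 §2). [folklore] -/
theorem kronecker_sum {α β γ δ τ : Type*} (s : Finset τ) (A : Matrix α β R) (B : τ → Matrix γ δ R) :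
    A ⊗ₖ (∑ t ∈ s, B t) = ∑ t ∈ s, A ⊗ₖ B t := by
  ext ⟨i₁, i₂⟩ ⟨j₁, j₂⟩
  simp [kroneckerMap_apply, Matrix.sum_apply, Finset.mul_sum]

omit [Fintype ι] [DecidableEq ι] [Fintype κ] [DecidableEq κ] in
/-- Adams operations via cyclic power operations (Atiyah 1966 §2). [folklore] -/
theorem kronecker_npow {α β : Type*} [Fintype α] [DecidableEq α] [Fintype β] [DecidableEq β] (A : Matrix α α R) (B : Matrix β β R) (n : ℕ) :
    (A ⊗ₖ B) ^ n = (A ^ n) ⊗ₖ (B ^ n) := by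
  induction n with
  | zero => rw [pow_zero, pow_zero, pow_zero, one_kronecker_one]
  | succ n ih => rw [pow_succ, ih, ← mul_kronecker_mul, ← pow_succ, ← pow_succ]

/-- Splitting slot functions into a product: `(Fin k → ι × κ) ≃ (Fin k → ι) × (Fin k → κ)`. [folklore] -/
abbrev slotProdEquiv (ι κ : Type*) (k : ℕ) : (Fin k → ι × κ) ≃ (Fin k → ι) × (Fin k → κ) :=
  Equiv.arrowProdEquivProdArrow (Fin k) (fun _ ↦ ι) (fun _ ↦ κ)

omit [Fintype ι] [DecidableEq ι] [Fintype κ] [DecidableEq κ] in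
/-- `(P ⊗ Q)^{⊗k} ≅ P^{⊗k} ⊗ Q^{⊗k}`. [cite: Atiyah1966PowerOperations, §2] -/
theorem tpow_kronecker_submatrix (P : Matrix ι ι R) (Q : Matrix κ κ R) :
    (tpow k (P ⊗ₖ Q)).submatrix (slotProdEquiv ι κ k).symm (slotProdEquiv ι κ k).symm = tpow k P ⊗ₖ tpow k Q := by
  ext ⟨i₁, i₂⟩ ⟨j₁, j₂⟩
  simp only [submatrix_apply, tpow_apply, kroneckerMap_apply, Equiv.arrowProdEquivProdArrow_symm_apply, Finset.prod_mul_distrib]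

/-- The cyclic shift of `(ι × κ)`-slots is the Kronecker product of the two cyclic shifts. [folklore] -/
theorem pm_prod_submatrix (σ : Equiv.Perm (Fin k)) :
    (pm R (ι × κ) σ).submatrix (slotProdEquiv ι κ k).symm (slotProdEquiv ι κ k).symm = pm R ι σ ⊗ₖ pm R κ σ := by
  ext ⟨i₁, i₂⟩ ⟨j₁, j₂⟩
  simp only [submatrix_apply, pm_apply, kroneckerMap_apply]
  have hiff : ((slotProdEquiv ι κ k).symm (i₁, i₂) ∘ ⇑σ = (slotProdEquiv ι κ k).symm (j₁, j₂)) ↔ (i₁ ∘ σ = j₁ ∧ i₂ ∘ σ = j₂) := by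
    simp only [funext_iff, Function.comp_apply, Equiv.arrowProdEquivProdArrow_symm_apply, Prod.mk.injEq]
    exact ⟨fun h ↦ ⟨fun c ↦ (h c).1, fun c ↦ (h c).2⟩, fun h c ↦ ⟨h.1 c, h.2 c⟩⟩
  by_cases h1 : i₁ ∘ σ = j₁ <;> by_cases h2 : i₂ ∘ σ = j₂ <;> simp [hiff, h1, h2]

end KronSlots

/-! ### 13. Multiplicativity `ψ^k[P ⊗ Q] = ψ^k[P] ψ^k[Q]` -/

section Mult

variable [Algebra ℂ R] {ι κ : Type*} [Fintype ι] [DecidableEq ι] [Fintype κ] [DecidableEq κ] {k : ℕ}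

/-- **The cyclic parts of a Kronecker product**:
`[V_j(P ⊗ Q)] = ∑_{a + b ≡ j} [V_a(P)] [V_b(Q)]` (Atiyah: multiplicativity of `ψ^k` "follows at
once from `(E ⊗ F)^{⊗k} ≅ E^{⊗k} ⊗ F^{⊗k}` and the multiplicative property of the trace").
[cite: Atiyah1966PowerOperations, §2 (after Prop. 2.3)] -/
theorem part_kronecker (hk : k ≠ 0) {P : Matrix ι ι R} {Q : Matrix κ κ R} (hP : IsIdempotentElem P) (hQ : IsIdempotentElem Q) (j : ℤ) :
    part k j (P ⊗ₖ Q) = ∑ ab : Fin k × Fin k, if (k : ℤ) ∣ (ab.1 : ℤ) + ab.2 - j then part k ab.1 P * part k ab.2 Q else 0 := by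
  set e := slotProdEquiv ι κ k with he
  set Tι := cyc R ι k with hTι
  set Tκ := cyc R κ k with hTκ
  have hTιk : Tι ^ k = 1 := cyc_pow_self
  have hTκk : Tκ ^ k = 1 := cyc_pow_self
  -- reindex to `P^{⊗k} ⊗ Q^{⊗k}`
  have h1 : part k j (P ⊗ₖ Q) = kc (eig k (Tι ⊗ₖ Tκ) j * (tpow k P ⊗ₖ tpow k Q)) := by
    rw [part, ← kc_submatrix (isIdempotentElem_eig_mul_tpow hk j (isIdempotentElem_kronecker hP hQ)) e.symm,
      ← submatrix_mul_equiv (e₂ := e.symm), eig_submatrix, he, pm_prod_submatrix, tpow_kronecker_submatrix]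
  -- the partition of unity `E_a(Tι) ⊗ E_b(Tκ)`
  set G : Fin k × Fin k → Matrix ((Fin k → ι) × (Fin k → κ)) ((Fin k → ι) × (Fin k → κ)) R :=
    fun ab ↦ eig k Tι ab.1 ⊗ₖ eig k Tκ ab.2 with hG
  have hGi : ∀ ab, IsIdempotentElem (G ab) := fun ab ↦
    isIdempotentElem_kronecker (isIdempotentElem_eig hk hTιk _) (isIdempotentElem_eig hk hTκk _)
  have hne : ∀ {a a' : Fin k}, a ≠ a' → ¬ (k : ℤ) ∣ (a' : ℤ) - a := by
    intro a a' h hd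
    apply h
    have ha := a.isLt
    have ha' := a'.isLt
    rcases hd with ⟨c, hc⟩
    have : (c : ℤ) = 0 := by
      rcases lt_trichotomy c 0 with hc0 | hc0 | hc0
      · nlinarith
      · exact hc0
      · nlinarith
    subst this
    exact Fin.ext (by omega)
  have hGo : ∀ ab ab', ab ≠ ab' → G ab * G ab' = 0 := by
    rintro ⟨a, b⟩ ⟨a', b'⟩ h
    change eig k Tι a ⊗ₖ eig k Tκ b * (eig k Tι a' ⊗ₖ eig k Tκ b') = 0
    rw [← mul_kronecker_mul]
    by_cases ha : a = a'
    · subst ha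
      have hb : b ≠ b' := fun hb ↦ h (by rw [hb])
      rw [eig_mul_eig_of_not_dvd hk hTκk (hne hb)]
      ext ⟨i₁, i₂⟩ ⟨j₁, j₂⟩; simp [kroneckerMap_apply]
    · rw [eig_mul_eig_of_not_dvd hk hTιk (hne ha)]
      ext ⟨i₁, i₂⟩ ⟨j₁, j₂⟩; simp [kroneckerMap_apply]
  have hGs : ∑ ab, G ab = 1 := by
    rw [Fintype.sum_prod_type]
    simp only [hG]
    rw [show (∑ a : Fin k, ∑ b : Fin k, eig k Tι a ⊗ₖ eig k Tκ b) = (∑ a : Fin k, eig k Tι a) ⊗ₖ (∑ b : Fin k, eig k Tκ b) by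
      rw [sum_kronecker]; exact Finset.sum_congr rfl fun a _ ↦ (kronecker_sum _ _ _).symm]
    rw [Fin.sum_univ_eq_sum_range (fun a ↦ eig k Tι a), Fin.sum_univ_eq_sum_range (fun b ↦ eig k Tκ b), sum_eig hk, sum_eig hk,
      one_kronecker_one]
  -- the idempotent to decompose
  set X := tpow k P ⊗ₖ tpow k Q with hX
  have hXi : IsIdempotentElem X := isIdempotentElem_kronecker (isIdempotentElem_tpow hP) (isIdempotentElem_tpow hQ)
  have hTT : (Tι ⊗ₖ Tκ) ^ k = 1 := by rw [kronecker_npow, hTιk, hTκk, one_kronecker_one]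
  have hTX : Tι ⊗ₖ Tκ * X = X * (Tι ⊗ₖ Tκ) := by
    rw [hX, ← mul_kronecker_mul, ← mul_kronecker_mul, hTι, hTκ, cyc_mul_tpow, cyc_mul_tpow]
  have hEX : IsIdempotentElem (eig k (Tι ⊗ₖ Tκ) j * X) := IsIdempotentElem.mul_of_commute (eig_comm hTX j) (isIdempotentElem_eig hk hTT j) hXi
  have hGT : ∀ ab, Tι ⊗ₖ Tκ * G ab = G ab * (Tι ⊗ₖ Tκ) := by
    rintro ⟨a, b⟩
    change Tι ⊗ₖ Tκ * (eig k Tι a ⊗ₖ eig k Tκ b) = eig k Tι a ⊗ₖ eig k Tκ b * (Tι ⊗ₖ Tκ)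
    rw [← mul_kronecker_mul, ← mul_kronecker_mul, ← eig_comm_self Tι, ← eig_comm_self Tκ]
  have hGX : ∀ ab, G ab * X = X * G ab := by
    rintro ⟨a, b⟩
    change eig k Tι a ⊗ₖ eig k Tκ b * (tpow k P ⊗ₖ tpow k Q) = tpow k P ⊗ₖ tpow k Q * (eig k Tι a ⊗ₖ eig k Tκ b)
    rw [← mul_kronecker_mul, ← mul_kronecker_mul, hTι, hTκ, eig_cyc_mul_tpow, eig_cyc_mul_tpow]
  have hGc : ∀ ab, G ab * (eig k (Tι ⊗ₖ Tκ) j * X) = eig k (Tι ⊗ₖ Tκ) j * X * G ab := by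
    intro ab
    rw [← Matrix.mul_assoc, (eig_comm (hGT ab) j).symm, Matrix.mul_assoc, hGX, Matrix.mul_assoc]
  -- eigenvalues of `Tι ⊗ Tκ` on `G ab`
  have hGeig : ∀ ab : Fin k × Fin k, (Tι ⊗ₖ Tκ) * G ab = (zeta k ^ ((ab.1 : ℤ) + ab.2)) • G ab := by
    rintro ⟨a, b⟩
    change Tι ⊗ₖ Tκ * (eig k Tι a ⊗ₖ eig k Tκ b) = (zeta k ^ ((a : ℤ) + b)) • (eig k Tι a ⊗ₖ eig k Tκ b)
    rw [← mul_kronecker_mul, mul_eig hTιk, mul_eig hTκk, smul_kronecker, kronecker_smul, smul_smul, ← zpow_add₀ (zeta_ne_zero k)]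
  rw [h1, kc_eq_sum_of_partition G hGi hGo hGs hEX hGc]
  refine Finset.sum_congr rfl fun ab _ ↦ ?_
  have hsel := eig_mul_of_mul_eq_smul hk _ (hGeig ab) j
  rw [← Matrix.mul_assoc, (eig_comm (hGT ab) j).symm, hsel]
  split_ifs with hd
  · rcases ab with ⟨a, b⟩
    change kc (eig k Tι a ⊗ₖ eig k Tκ b * (tpow k P ⊗ₖ tpow k Q)) = part k a P * part k b Q
    rw [← mul_kronecker_mul, kc_kronecker (isIdempotentElem_eig_mul_tpow hk _ hP) (isIdempotentElem_eig_mul_tpow hk _ hQ)]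
    rfl
  · rw [Matrix.zero_mul, kc_zero]

/-- **`ψ²[P ⊗ Q] = ψ²[P] ψ²[Q]`**. [cite: Atiyah1966PowerOperations, §2 (after Prop. 2.3)] -/
theorem psiM_two_kronecker {P : Matrix ι ι R} {Q : Matrix κ κ R} (hP : IsIdempotentElem P) (hQ : IsIdempotentElem Q) :
    psiM 2 (P ⊗ₖ Q) = psiM 2 P * psiM 2 Q := by
  rw [psiM, part_kronecker two_ne_zero hP hQ, part_kronecker two_ne_zero hP hQ, psiM, psiM]
  simp only [Fintype.sum_prod_type, Fin.sum_univ_two, Fin.val_zero, Fin.val_one, Nat.cast_zero, Nat.cast_one]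
  norm_num
  ring

/-- **`ψ³[P ⊗ Q] = ψ³[P] ψ³[Q]`** (using `[V_1] = [V_2]`). [cite: Atiyah1966PowerOperations, §2 (after Prop. 2.3)] -/
theorem psiM_three_kronecker {P : Matrix ι ι R} {Q : Matrix κ κ R} (hP : IsIdempotentElem P) (hQ : IsIdempotentElem Q) :
    psiM 3 (P ⊗ₖ Q) = psiM 3 P * psiM 3 Q := by
  have h3 : (3 : ℕ) ≠ 0 := by decide
  obtain ⟨τ, hτ⟩ := IsAdamsPrime.exists_inverter 3
  have hP2 : part 3 2 P = part 3 1 P := by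
    have h := part_add_mul (R := R) (k := 3) (-1) 1 P
    norm_num at h
    rw [h, part_neg h3 hτ hP]
  have hQ2 : part 3 2 Q = part 3 1 Q := by
    have h := part_add_mul (R := R) (k := 3) (-1) 1 Q
    norm_num at h
    rw [h, part_neg h3 hτ hQ]
  rw [psiM, part_kronecker h3 hP hQ, part_kronecker h3 hP hQ, psiM, psiM]
  simp only [Fintype.sum_prod_type, Fin.sum_univ_three, Fin.val_zero, Fin.val_one, Fin.val_two, Nat.cast_zero, Nat.cast_one,
    Nat.cast_ofNat]
  norm_num
  rw [hP2, hQ2]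
  ring

/-- **Multiplicativity of `ψ^k` on Kronecker products** (`k = 2, 3`). [cite: Atiyah1966PowerOperations, §2 (after Prop. 2.3)] -/
theorem psiM_kronecker (k : ℕ) [h : IsAdamsPrime k] {P : Matrix ι ι R} {Q : Matrix κ κ R} (hP : IsIdempotentElem P)
    (hQ : IsIdempotentElem Q) : psiM k (P ⊗ₖ Q) = psiM k P * psiM k Q := by
  rcases h.out with rfl | rfl
  · exact psiM_two_kronecker hP hQ
  · exact psiM_three_kronecker hP hQ

end Mult

/-! ### 14. `ψ^k` is a ring endomorphism of `K₀(R)`; line elements; `ψ²(x) ≡ x²` -/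

section RingHom

variable [Algebra ℂ R] {ι : Type*} [Fintype ι] [DecidableEq ι] {k : ℕ}

/-- **`ψ^k(x y) = ψ^k(x) ψ^k(y)`**. [cite: Atiyah1966PowerOperations, §2 (after Prop. 2.3)] -/
theorem psi_mul (k : ℕ) [IsAdamsPrime k] (x y : KZero R) : psi R k (x * y) = psi R k x * psi R k y := by
  obtain ⟨p, q, rfl⟩ := KZero.exists_of_sub_of x
  obtain ⟨p', q', rfl⟩ := KZero.exists_of_sub_of y
  have hmul : ∀ a b : Idem R, psi R k (KZero.of a * KZero.of b) = psi R k (KZero.of a) * psi R k (KZero.of b) := by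
    intro a b
    rw [← kc_mat a, ← kc_mat b, ← kc_kronecker a.isIdempotentElem b.isIdempotentElem,
      psi_kc k (isIdempotentElem_kronecker a.isIdempotentElem b.isIdempotentElem), psi_kc k a.isIdempotentElem,
      psi_kc k b.isIdempotentElem, psiM_kronecker k a.isIdempotentElem b.isIdempotentElem]
  simp only [sub_mul, mul_sub, map_sub, hmul]

/-- The class of a `1 × 1` identity matrix is `1`, and it is a line element: **`ψ^k(1) = 1`**. [cite: Atiyah1966PowerOperations, §2 (2.7)] -/
theorem psi_one (k : ℕ) [IsAdamsPrime k] : psi R k 1 = 1 := by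
  have h1 : kc (1 : Matrix (Fin 1) (Fin 1) R) = 1 := by rw [kc_one]; simp
  rw [← h1, psi_kc k IsIdempotentElem.one, (isLine_of_subsingleton _).psiM_eq (IsAdamsPrime.two_le k) IsIdempotentElem.one, h1, one_pow]

/-- **The Adams operation as a ring endomorphism `ψ^k : K₀(R) →+* K₀(R)`** (`k = 2, 3`). [cite: Atiyah1966PowerOperations, §2] -/
def psiRingHom (R : Type u) [CommRing R] [Algebra ℂ R] (k : ℕ) [IsAdamsPrime k] : KZero R →+* KZero R :=
  { psi R k with
    map_one' := psi_one k
    map_mul' := psi_mul k }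

/-- Adams operations via cyclic power operations (Atiyah 1966 §2). [folklore] -/
@[simp] theorem psiRingHom_apply (k : ℕ) [IsAdamsPrime k] (x : KZero R) : psiRingHom R k x = psi R k x := rfl

/-- **`ψ^k [L] = [L]^k` for a line element `L`** (e.g. a line bundle). [cite: Atiyah1966PowerOperations, §2 (2.7)] -/
theorem psi_kc_of_isLine (k : ℕ) [IsAdamsPrime k] {L : Matrix ι ι R} (hL : IsLine L) (hLi : IsIdempotentElem L) :
    psi R k (kc L) = kc L ^ k := by
  rw [psi_kc k hLi, hL.psiM_eq (IsAdamsPrime.two_le k) hLi]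

/-- `[M]² = [V_0] + [V_1]` for `k = 2`: the two eigenbundles of the swap exhaust `M ⊗ M`. [cite: Atiyah1966PowerOperations, §2 Prop. 2.5] -/
theorem kc_sq_eq_part_add_part {M : Matrix ι ι R} (hM : IsIdempotentElem M) : kc M ^ 2 = part 2 0 M + part 2 1 M := by
  rw [← kc_tpow hM 2]
  have hT : cyc R ι 2 ^ 2 = 1 := cyc_pow_self
  set G : Fin 2 → Matrix (Fin 2 → ι) (Fin 2 → ι) R := fun a ↦ eig 2 (cyc R ι 2) a with hG
  have hGs : ∑ a, G a = 1 := by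
    rw [Fin.sum_univ_eq_sum_range (fun a ↦ eig 2 (cyc R ι 2) a), sum_eig two_ne_zero]
  have hGo : ∀ a a', a ≠ a' → G a * G a' = 0 := by
    intro a a' h
    simp only [hG]
    apply eig_mul_eig_of_not_dvd two_ne_zero hT
    fin_cases a <;> fin_cases a' <;> simp_all
  rw [kc_eq_sum_of_partition G (fun a ↦ isIdempotentElem_eig two_ne_zero hT _) hGo hGs (isIdempotentElem_tpow hM)
    (fun a ↦ eig_cyc_mul_tpow _ M)]
  simp only [Fin.sum_univ_two, hG, Fin.val_zero, Fin.val_one, Nat.cast_zero, Nat.cast_one]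
  rfl

/-- `ψ²[M] = [M]² - 2 [V_1]`. [cite: Atiyah1966PowerOperations, §2 Prop. 2.5] -/
theorem psiM_two_eq {M : Matrix ι ι R} (hM : IsIdempotentElem M) : psiM 2 M = kc M ^ 2 - 2 * part 2 1 M := by
  rw [psiM, kc_sq_eq_part_add_part hM]; ring

/-- **`ψ²(x) ≡ x² (mod 2)`** in `K₀(R)` (Atiyah Prop. 2.5 / (2.6) for `p = 2`). [cite: Atiyah1966PowerOperations, §2 Prop. 2.5] -/
theorem exists_psi_two_sub_sq (x : KZero R) : ∃ y : KZero R, psi R 2 x - x * x = 2 * y := by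
  obtain ⟨p, q, rfl⟩ := KZero.exists_of_sub_of x
  refine ⟨part 2 1 q.mat - part 2 1 p.mat - KZero.of q * KZero.of q + KZero.of p * KZero.of q, ?_⟩
  rw [map_sub, psi_of, psi_of, psiM_two_eq p.isIdempotentElem, psiM_two_eq q.isIdempotentElem, kc_mat, kc_mat]
  ring

/-- **Naturality of `ψ^k`** under `ℂ`-algebra homomorphisms: `K₀(f) ∘ ψ^k = ψ^k ∘ K₀(f)`. [cite: Atiyah1966PowerOperations, §2] -/
theorem map_psi {S : Type*} [CommRing S] [Algebra ℂ S] (f : R →ₐ[ℂ] S) (k : ℕ) [IsAdamsPrime k] (x : KZero R) :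
    KZero.map f.toRingHom (psi R k x) = psi S k (KZero.map f.toRingHom x) := by
  obtain ⟨p, q, rfl⟩ := KZero.exists_of_sub_of x
  have h : ∀ a : Idem R, KZero.map f.toRingHom (psi R k (KZero.of a)) = psi S k (KZero.map f.toRingHom (KZero.of a)) := by
    intro a
    rw [psi_of, map_psiM f (IsAdamsPrime.ne_zero k) a.isIdempotentElem, KZero.map_of, psi_of]
    rfl
  simp only [map_sub, h]

end RingHom








/-! ### 15. Iterated tensor powers: the double slot structure -/

section Double

variable {ι κ : Type*} [Fintype ι] [DecidableEq ι] [Fintype κ] [DecidableEq κ] {N : ℕ}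

omit [Fintype ι] [DecidableEq ι] [Fintype κ] [DecidableEq κ] in
/-- **Multilinearity of the slotwise tensor product**: summing over all slot-labellings. [folklore] -/
theorem sum_tpowF_pi {τ : Type*} [Fintype τ] [DecidableEq τ] (A : τ → Matrix ι κ R) :
    ∑ t : Fin N → τ, tpowF (fun a ↦ A (t a)) = tpow N (∑ c, A c) := by
  ext i j
  rw [Matrix.sum_apply, tpow_apply]
  simp only [tpowF_apply, Matrix.sum_apply]
  rw [Finset.prod_univ_sum (fun _ ↦ (Finset.univ : Finset τ)) (fun a c ↦ A c (i a) (j a))]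
  simp only [Fintype.piFinset_univ]

variable [Algebra ℂ R]

omit [Fintype ι] [DecidableEq ι] [Fintype κ] [DecidableEq κ] in
/-- Scalars come out of the slotwise tensor product as a product. [folklore] -/
theorem tpowF_smul (c : Fin N → ℂ) (A : Fin N → Matrix ι κ R) : tpowF (fun a ↦ c a • A a) = (∏ a, c a) • tpowF A := by
  ext i j
  simp only [tpowF_apply, Matrix.smul_apply, Algebra.smul_def, Finset.prod_mul_distrib, map_prod]

omit [Algebra ℂ R] in
/-- Adams operations via cyclic power operations (Atiyah 1966 §2). [folklore] -/
theorem tpow_pow (n : ℕ) (A : Matrix ι ι R) : tpow N A ^ n = tpow N (A ^ n) := by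
  induction n with
  | zero => rw [pow_zero, pow_zero, tpow_one]
  | succ n ih => rw [pow_succ, ih, ← tpow_mul, ← pow_succ]

/-- The **flip** of a double slot structure: `(Fin kk → Fin l → ι) ≃ (Fin l → Fin kk → ι)`. [folklore] -/
def flipE (ι : Type*) (kk l : ℕ) : (Fin kk → Fin l → ι) ≃ (Fin l → Fin kk → ι) where
  toFun i := fun b a ↦ i a b
  invFun i := fun a b ↦ i b a
  left_inv _ := rfl
  right_inv _ := rfl

omit [Algebra ℂ R] [Fintype ι] [DecidableEq ι] in
/-- Adams operations via cyclic power operations (Atiyah 1966 §2). [folklore] -/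
@[simp] theorem flipE_apply (kk l : ℕ) (i : Fin kk → Fin l → ι) (b : Fin l) (a : Fin kk) : flipE ι kk l i b a = i a b := rfl

omit [Algebra ℂ R] [Fintype ι] [DecidableEq ι] in
/-- Flipping the double tensor power. [folklore] -/
theorem tpow_tpow_submatrix_flipE (kk l : ℕ) (M : Matrix ι ι R) :
    (tpow l (tpow kk M)).submatrix (flipE ι kk l) (flipE ι kk l) = tpow kk (tpow l M) := by
  ext i j
  simp only [submatrix_apply, tpow_apply, flipE_apply]
  exact Finset.prod_comm

omit [Algebra ℂ R] in
/-- Under the flip, the outer rotation of the `(l, kk)` structure is the simultaneous inner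
rotation of the `(kk, l)` structure. [folklore] -/
theorem cyc_submatrix_flipE (kk l : ℕ) :
    (cyc R (Fin kk → ι) l).submatrix (flipE ι kk l) (flipE ι kk l) = tpow kk (cyc R ι l) := by
  ext i j
  simp only [submatrix_apply, pm_apply, tpow_apply]
  rw [Finset.prod_boole]
  congr 1
  apply propext
  simp only [funext_iff, Function.comp_apply, flipE_apply, Finset.mem_univ, true_implies]
  exact ⟨fun h a b ↦ h b a, fun h b a ↦ h a b⟩

omit [Algebra ℂ R] in
/-- Under the flip, the simultaneous inner rotation of the `(l, kk)` structure is the outer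
rotation of the `(kk, l)` structure. [folklore] -/
theorem tpow_cyc_submatrix_flipE (kk l : ℕ) :
    (tpow l (cyc R ι kk)).submatrix (flipE ι kk l) (flipE ι kk l) = cyc R (Fin l → ι) kk := by
  ext i j
  simp only [submatrix_apply, pm_apply, tpow_apply]
  rw [Finset.prod_boole]
  congr 1
  apply propext
  simp only [funext_iff, Function.comp_apply, flipE_apply, Finset.mem_univ, true_implies]
  exact ⟨fun h a b ↦ h b a, fun h b a ↦ h a b⟩

end Double

/-! ### 16. The joint classes `H(kk, l; e, m)` and their symmetries -/

section Joint

variable [Algebra ℂ R] {ι : Type*} [Fintype ι] [DecidableEq ι]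

/-- The inner eigen-part `X_c = E_c(T) M^{⊗l}` (so that `part l c M = [X_c]`). [cite: Atiyah1966PowerOperations, §2 (2.7)] -/
def innerX (l : ℕ) (c : ℤ) (M : Matrix ι ι R) : Matrix (Fin l → ι) (Fin l → ι) R := eig l (cyc R ι l) c * tpow l M

/-- Adams operations via cyclic power operations (Atiyah 1966 §2). [folklore] -/
theorem part_eq_kc_innerX (l : ℕ) (c : ℤ) (M : Matrix ι ι R) : part l c M = kc (innerX l c M) := rfl

/-- The **joint class** `H(kk, l; e, m) = [E_e(β) E_m(δ) (M^{⊗l})^{⊗kk}]` of the commuting pair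
(outer rotation `β` of order `kk`, simultaneous inner rotation `δ` of order `l`) acting on
`M^{⊗ kk l}`; `ψ^kk ψ^l [M]` is an alternating sum of these. [cite: Atiyah1966PowerOperations, §2] -/
def Hcls (kk l : ℕ) (e m : ℤ) (M : Matrix ι ι R) : KZero R :=
  kc (eig kk (cyc R (Fin l → ι) kk) e * eig l (tpow kk (cyc R ι l)) m * tpow kk (tpow l M))

variable {kk l : ℕ}

omit [Algebra ℂ R] in
/-- Adams operations via cyclic power operations (Atiyah 1966 §2). [folklore] -/
theorem delta_pow_self : (tpow kk (cyc R ι l)) ^ l = 1 := by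
  rw [tpow_pow, cyc_pow_self, tpow_one]

omit [Algebra ℂ R] in
/-- Adams operations via cyclic power operations (Atiyah 1966 §2). [folklore] -/
theorem beta_mul_delta : cyc R (Fin l → ι) kk * tpow kk (cyc R ι l) = tpow kk (cyc R ι l) * cyc R (Fin l → ι) kk :=
  pm_mul_tpow _ _

omit [Algebra ℂ R] in
/-- Adams operations via cyclic power operations (Atiyah 1966 §2). [folklore] -/
theorem delta_mul_TP (M : Matrix ι ι R) : tpow kk (cyc R ι l) * tpow kk (tpow l M) = tpow kk (tpow l M) * tpow kk (cyc R ι l) := by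
  rw [← tpow_mul, cyc_mul_tpow, tpow_mul]

/-- **Flip symmetry**: `H(kk, l; e, m) = H(l, kk; m, e)`. [folklore] -/
theorem Hcls_flip (hkk : kk ≠ 0) (hl : l ≠ 0) (e m : ℤ) {M : Matrix ι ι R} (hM : IsIdempotentElem M) :
    Hcls kk l e m M = Hcls l kk m e M := by
  rw [Hcls, Hcls]
  -- idempotency of the `(l, kk)` representative
  have hβ' : (cyc R (Fin kk → ι) l) ^ l = 1 := cyc_pow_self
  have hδ' : (tpow l (cyc R ι kk)) ^ kk = 1 := delta_pow_self
  have hTP' : IsIdempotentElem (tpow l (tpow kk M)) := isIdempotentElem_tpow (isIdempotentElem_tpow hM)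
  have hc1 : cyc R (Fin kk → ι) l * tpow l (cyc R ι kk) = tpow l (cyc R ι kk) * cyc R (Fin kk → ι) l := beta_mul_delta
  have hEE : eig l (cyc R (Fin kk → ι) l) m * eig kk (tpow l (cyc R ι kk)) e =
      eig kk (tpow l (cyc R ι kk)) e * eig l (cyc R (Fin kk → ι) l) m :=
    eig_comm (eig_comm hc1.symm e).symm m
  have hβTP : cyc R (Fin kk → ι) l * tpow l (tpow kk M) = tpow l (tpow kk M) * cyc R (Fin kk → ι) l := cyc_mul_tpow _
  have hδTP : tpow l (cyc R ι kk) * tpow l (tpow kk M) = tpow l (tpow kk M) * tpow l (cyc R ι kk) := delta_mul_TP M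
  have hY : IsIdempotentElem (eig l (cyc R (Fin kk → ι) l) m * eig kk (tpow l (cyc R ι kk)) e * tpow l (tpow kk M)) := by
    refine IsIdempotentElem.mul_of_commute ?_ (IsIdempotentElem.mul_of_commute hEE (isIdempotentElem_eig hl hβ' m)
      (isIdempotentElem_eig hkk hδ' e)) hTP'
    change _ * _ = _ * _
    rw [Matrix.mul_assoc, eig_comm hδTP e, ← Matrix.mul_assoc, eig_comm hβTP m, Matrix.mul_assoc]
  rw [← kc_submatrix hY (flipE ι kk l), ← submatrix_mul_equiv (e₂ := flipE ι kk l), ← submatrix_mul_equiv (e₂ := flipE ι kk l),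
    eig_submatrix, eig_submatrix, cyc_submatrix_flipE, tpow_cyc_submatrix_flipE, tpow_tpow_submatrix_flipE]
  congr 1
  rw [(eig_comm (eig_comm beta_mul_delta.symm m).symm e)]

/-- **Reflection symmetry in the outer index**: `H(kk, l; e, m) = H(kk, l; -e, m)`. [folklore] -/
theorem Hcls_neg_left (hkk : kk ≠ 0) (hl : l ≠ 0) {τ : Equiv.Perm (Fin kk)} (hτ : τ * finRotate kk * τ⁻¹ = (finRotate kk)⁻¹) (e m : ℤ)
    {M : Matrix ι ι R} (hM : IsIdempotentElem M) : Hcls kk l (-e) m M = Hcls kk l e m M := by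
  rw [Hcls, Hcls, ← conj_eig_cyc_of_inverts hkk hτ e]
  set β := cyc R (Fin l → ι) kk
  set δ := tpow kk (cyc R ι l)
  set TP := tpow kk (tpow l M)
  have hδ : δ ^ l = 1 := delta_pow_self
  have hβk : β ^ kk = 1 := cyc_pow_self
  have hτδ : pm R (Fin l → ι) τ⁻¹ * δ = δ * pm R (Fin l → ι) τ⁻¹ := pm_mul_tpow _ _
  have hτTP : pm R (Fin l → ι) τ⁻¹ * TP = TP * pm R (Fin l → ι) τ⁻¹ := pm_mul_tpow _ _
  have hY : IsIdempotentElem (eig kk β e * eig l δ m * TP) := by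
    refine IsIdempotentElem.mul_of_commute ?_ (IsIdempotentElem.mul_of_commute (eig_comm (eig_comm beta_mul_delta.symm m).symm e)
      (isIdempotentElem_eig hkk hβk e) (isIdempotentElem_eig hl hδ m)) (isIdempotentElem_tpow (isIdempotentElem_tpow hM))
    change _ * _ = _ * _
    rw [Matrix.mul_assoc, eig_comm (delta_mul_TP M) m, ← Matrix.mul_assoc, eig_comm (cyc_mul_tpow _) e, Matrix.mul_assoc]
  rw [← kc_conj hY (pm_inv_mul τ)]
  congr 1
  simp only [Matrix.mul_assoc]
  congr 2
  rw [← Matrix.mul_assoc, ← eig_comm hτδ.symm m, Matrix.mul_assoc, hτTP]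

/-- **Reflection symmetry in the inner index**: `H(kk, l; e, m) = H(kk, l; e, -m)`. [folklore] -/
theorem Hcls_neg_right (hkk : kk ≠ 0) (hl : l ≠ 0) {τ : Equiv.Perm (Fin l)} (hτ : τ * finRotate l * τ⁻¹ = (finRotate l)⁻¹) (e m : ℤ)
    {M : Matrix ι ι R} (hM : IsIdempotentElem M) : Hcls kk l e (-m) M = Hcls kk l e m M := by
  rw [Hcls_flip hkk hl e (-m) hM, Hcls_neg_left hl hkk hτ m e hM, ← Hcls_flip hkk hl e m hM]

/-! #### The family of slotwise inner eigen-idempotents -/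

/-- `G_t = ⊗_a E_{t a}(T)`, the joint eigen-idempotent of the `kk` commuting inner rotations. [cite: Atiyah1966PowerOperations, §2] -/
def jointG (kk l : ℕ) (t : Fin kk → Fin l) : Matrix (Fin kk → Fin l → ι) (Fin kk → Fin l → ι) R :=
  tpowF fun a ↦ eig l (cyc R ι l) (t a)

/-- Adams operations via cyclic power operations (Atiyah 1966 §2). [folklore] -/
theorem isIdempotentElem_jointG (hl : l ≠ 0) (t : Fin kk → Fin l) : IsIdempotentElem (jointG (R := R) (ι := ι) kk l t) :=
  isIdempotentElem_tpowF fun _ ↦ isIdempotentElem_eig hl cyc_pow_self _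

/-- Adams operations via cyclic power operations (Atiyah 1966 §2). [folklore] -/
theorem jointG_mul_jointG_of_ne (hl : l ≠ 0) {t t' : Fin kk → Fin l} (h : t ≠ t') : jointG (R := R) (ι := ι) kk l t * jointG kk l t' = 0 := by
  obtain ⟨a, ha⟩ : ∃ a, t a ≠ t' a := by
    by_contra h'
    push Not at h'
    exact h (funext h')
  rw [jointG, jointG, ← tpowF_mul]
  apply tpowF_zero a
  apply eig_mul_eig_of_not_dvd hl cyc_pow_self
  intro hd
  apply ha
  have h1 := (t a).isLt
  have h2 := (t' a).isLt
  rcases hd with ⟨c, hc⟩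
  have : (c : ℤ) = 0 := by
    rcases lt_trichotomy c 0 with hc0 | hc0 | hc0
    · nlinarith
    · exact hc0
    · nlinarith
  subst this
  exact Fin.ext (by omega)

/-- Adams operations via cyclic power operations (Atiyah 1966 §2). [folklore] -/
theorem sum_jointG (hl : l ≠ 0) : ∑ t : Fin kk → Fin l, jointG (R := R) (ι := ι) kk l t = 1 := by
  unfold jointG
  rw [sum_tpowF_pi (fun c : Fin l ↦ eig l (cyc R ι l) c), Fin.sum_univ_eq_sum_range (fun c ↦ eig l (cyc R ι l) c), sum_eig hl, tpow_one]

/-- Adams operations via cyclic power operations (Atiyah 1966 §2). [folklore] -/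
theorem beta_mul_jointG (t : Fin kk → Fin l) :
    cyc R (Fin l → ι) kk * jointG kk l t = jointG kk l (t ∘ ⇑(finRotate kk)⁻¹) * cyc R (Fin l → ι) kk := by
  rw [jointG, jointG, cyc, pm_mul_tpowF]
  rfl

/-- Adams operations via cyclic power operations (Atiyah 1966 §2). [folklore] -/
theorem jointG_mul_delta (t : Fin kk → Fin l) : jointG (R := R) (ι := ι) kk l t * tpow kk (cyc R ι l) = tpow kk (cyc R ι l) * jointG kk l t := by
  rw [jointG, ← tpowF_mul, ← tpowF_mul]
  congr 1
  funext a
  exact eig_comm_self _ _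

omit [Algebra ℂ R] [Fintype ι] [DecidableEq ι] in
/-- Adams operations via cyclic power operations (Atiyah 1966 §2). [folklore] -/
theorem tpow_eq_tpowF (N : ℕ) (A : Matrix ι ι R) : tpow N A = tpowF (fun _ : Fin N ↦ A) := rfl

/-- Adams operations via cyclic power operations (Atiyah 1966 §2). [folklore] -/
theorem jointG_mul_TP (t : Fin kk → Fin l) (M : Matrix ι ι R) :
    jointG (R := R) (ι := ι) kk l t * tpow kk (tpow l M) = tpow kk (tpow l M) * jointG kk l t := by
  rw [jointG, tpow_eq_tpowF kk, ← tpowF_mul, ← tpowF_mul]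
  congr 1
  funext a
  exact eig_cyc_mul_tpow _ _

/-- The eigenvalue of the simultaneous inner rotation on `G_t` is `ζ_l^{∑_a t a}`. [folklore] -/
theorem delta_mul_jointG (t : Fin kk → Fin l) :
    tpow kk (cyc R ι l) * jointG kk l t = (zeta l ^ ((∑ a, (t a : ℕ) : ℕ) : ℤ)) • jointG (R := R) (ι := ι) kk l t := by
  rw [jointG, tpow_eq_tpowF kk, ← tpowF_mul]
  have h : (fun a ↦ cyc R ι l * eig l (cyc R ι l) (t a)) = fun a ↦ (zeta l ^ ((t a : ℕ) : ℤ)) • eig l (cyc R ι l) (t a) := by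
    funext a; exact mul_eig cyc_pow_self _
  rw [h, tpowF_smul]
  congr 1
  rw [zpow_natCast, ← Finset.prod_pow_eq_pow_sum]
  exact Finset.prod_congr rfl fun a _ ↦ by rw [zpow_natCast]

/-- For a constant labelling, `G_{const c} (M^{⊗l})^{⊗kk} = (X_c)^{⊗kk}`. [folklore] -/
theorem jointG_const_mul_TP (c : Fin l) (M : Matrix ι ι R) :
    jointG (R := R) (ι := ι) kk l (fun _ ↦ c) * tpow kk (tpow l M) = tpow kk (innerX l c M) := by
  rw [jointG, tpow_eq_tpowF kk, ← tpowF_mul]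
  rfl

/-- **The alternating outer sum of joint classes computes `ψ^kk` of the inner parts**:
`H(kk,l;0,m) - H(kk,l;1,m) = ∑_{c : l ∣ kk c - m} ψ^kk [X_c]`. [cite: Atiyah1966PowerOperations, §2 Prop. 2.3] -/
theorem Hcls_zero_sub_one (hkk : kk ≠ 0) (hl : l ≠ 0) (pe : (Fin kk → Fin l) → ℕ)
    (hpe : ∀ t, slotEquiv (Fin l) (finRotate kk)⁻¹ t ≠ t → (pe (slotEquiv (Fin l) (finRotate kk)⁻¹ t) : ZMod kk) = pe t + 1)
    (hfix : univ.filter (fun t ↦ slotEquiv (Fin l) (finRotate kk)⁻¹ t = t) = univ.image (fun c : Fin l ↦ (fun _ : Fin kk ↦ c)))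
    {M : Matrix ι ι R} (hM : IsIdempotentElem M) (m : ℤ) :
    Hcls kk l 0 m M - Hcls kk l 1 m M = ∑ c : Fin l, if (l : ℤ) ∣ (kk : ℤ) * c - m then psiM kk (innerX l c M) else 0 := by
  set β := cyc R (Fin l → ι) kk with hβdef
  set δ := tpow kk (cyc R ι l) with hδdef
  set TP := tpow kk (tpow l M) with hTPdef
  have hβk : β ^ kk = 1 := cyc_pow_self
  have hδl : δ ^ l = 1 := delta_pow_self
  have hTPi : IsIdempotentElem TP := isIdempotentElem_tpow (isIdempotentElem_tpow hM)
  set Q := eig l δ m * TP with hQ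
  have hQi : IsIdempotentElem Q := IsIdempotentElem.mul_of_commute (eig_comm (delta_mul_TP M) m) (isIdempotentElem_eig hl hδl m) hTPi
  have hβQ : β * Q = Q * β := by
    rw [hQ, ← Matrix.mul_assoc, (eig_comm beta_mul_delta.symm m).symm, Matrix.mul_assoc, cyc_mul_tpow, Matrix.mul_assoc]
  have hGQ : ∀ t, jointG kk l t * Q = Q * jointG kk l t := by
    intro t
    rw [hQ, ← Matrix.mul_assoc, (eig_comm (jointG_mul_delta t).symm m).symm, Matrix.mul_assoc, jointG_mul_TP, Matrix.mul_assoc]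
  have hcor := kc_eig_zero_sub_one_eq_sum_fixed hkk hβk (jointG kk l) (isIdempotentElem_jointG hl)
    (fun t t' h ↦ jointG_mul_jointG_of_ne hl h) (sum_jointG hl) (slotEquiv (Fin l) (finRotate kk)⁻¹)
    (fun t ↦ beta_mul_jointG t) pe hpe hQi hβQ hGQ
  have hL : ∀ e : ℤ, kc (eig kk β e * Q) = Hcls kk l e m M := fun e ↦ by rw [Hcls, hQ, ← Matrix.mul_assoc]
  rw [hL, hL] at hcor
  rw [hcor, hfix, Finset.sum_image]
  · refine Finset.sum_congr rfl fun c _ ↦ ?_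
    -- the eigenvalue of `δ` on `G_{const c}` is `ζ_l^{kk c}`
    have heig : δ * jointG kk l (fun _ : Fin kk ↦ c) = (zeta l ^ ((kk : ℤ) * c)) • jointG (R := R) (ι := ι) kk l (fun _ ↦ c) := by
      rw [hδdef, delta_mul_jointG]
      simp
    have hsel := eig_mul_of_mul_eq_smul hl _ heig m
    have hGE : ∀ e : ℤ, jointG kk l (fun _ ↦ c) * eig kk β e = eig kk β e * jointG kk l (fun _ ↦ c) := by
      intro e
      have hfixc : β * jointG kk l (fun _ ↦ c) = jointG kk l (fun _ ↦ c) * β := beta_mul_jointG _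
      exact (eig_comm hfixc e).symm
    have hstep : ∀ e : ℤ, kc (jointG kk l (fun _ ↦ c) * eig kk β e * Q) = if (l : ℤ) ∣ (kk : ℤ) * c - m then part kk e (innerX l c M) else 0 := by
      intro e
      rw [hGE, Matrix.mul_assoc, hQ, ← Matrix.mul_assoc (jointG kk l _), ← (eig_comm (jointG_mul_delta _).symm m), hsel]
      split_ifs with hd
      · rw [jointG_const_mul_TP, part]
      · rw [Matrix.zero_mul, Matrix.mul_zero, kc_zero]
    rw [hstep, hstep]
    split_ifs
    · rfl
    · rw [sub_zero]
  · intro c _ c' _ h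
    exact congrFun h ⟨0, Nat.pos_of_ne_zero hkk⟩

end Joint

/-! ### 17. `ψ² ψ³ = ψ³ ψ²` -/

section Commute

variable [Algebra ℂ R] {ι : Type*} [Fintype ι] [DecidableEq ι]

/-- Adams operations via cyclic power operations (Atiyah 1966 §2). [folklore] -/
theorem isIdempotentElem_innerX {l : ℕ} (hl : l ≠ 0) (c : ℤ) {M : Matrix ι ι R} (hM : IsIdempotentElem M) :
    IsIdempotentElem (innerX l c M) := isIdempotentElem_eig_mul_tpow hl c hM

/-- `ψ^kk (ψ^l [M]) = ψ^kk[X_0] - ψ^kk[X_1]`. [cite: Atiyah1966PowerOperations, §2 (2.7)] -/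
theorem psi_psi_kc (kk l : ℕ) [IsAdamsPrime kk] [IsAdamsPrime l] {M : Matrix ι ι R} (hM : IsIdempotentElem M) :
    psi R kk (psi R l (kc M)) = psiM kk (innerX l 0 M) - psiM kk (innerX l 1 M) := by
  rw [psi_kc l hM, psiM, part_eq_kc_innerX, part_eq_kc_innerX, map_sub,
    psi_kc kk (isIdempotentElem_innerX (IsAdamsPrime.ne_zero l) 0 hM), psi_kc kk (isIdempotentElem_innerX (IsAdamsPrime.ne_zero l) 1 hM)]

/-- `ψ²ψ³[M]` in terms of joint classes. [cite: Atiyah1966PowerOperations, §2] -/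
theorem psi_two_psi_three_kc {M : Matrix ι ι R} (hM : IsIdempotentElem M) :
    psi R 2 (psi R 3 (kc M)) = (Hcls 2 3 0 0 M - Hcls 2 3 1 0 M) - (Hcls 2 3 0 2 M - Hcls 2 3 1 2 M) := by
  have h := Hcls_zero_sub_one (kk := 2) (l := 3) (R := R) two_ne_zero three_ne_zero
    (fun t ↦ if t 0 = t 1 then 0 else (if (t 0 : ℕ) < t 1 then 0 else 1)) (by decide) (by decide) hM
  have h0 := h 0
  have h2 := h 2
  simp only [Fin.sum_univ_three, Fin.val_zero, Fin.val_one, Fin.val_two, Nat.cast_zero, Nat.cast_one, Nat.cast_ofNat] at h0 h2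
  norm_num at h0 h2
  rw [psi_psi_kc 2 3 hM, ← h0, ← h2]

/-- `ψ³ψ²[M]` in terms of joint classes. [cite: Atiyah1966PowerOperations, §2] -/
theorem psi_three_psi_two_kc {M : Matrix ι ι R} (hM : IsIdempotentElem M) :
    psi R 3 (psi R 2 (kc M)) = (Hcls 3 2 0 0 M - Hcls 3 2 1 0 M) - (Hcls 3 2 0 1 M - Hcls 3 2 1 1 M) := by
  have h := Hcls_zero_sub_one (kk := 3) (l := 2) (R := R) three_ne_zero two_ne_zero
    (fun t ↦ if t 0 = t 1 then 2 else if t 0 = t 2 then 1 else 0) (by decide) (by decide) hM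
  have h0 := h 0
  have h1 := h 1
  simp only [Fin.sum_univ_two, Fin.val_zero, Fin.val_one, Nat.cast_zero, Nat.cast_one] at h0 h1
  norm_num at h0 h1
  rw [psi_psi_kc 3 2 hM, ← h0, ← h1]

/-- **`ψ² ψ³ = ψ³ ψ²` on classes of idempotents.** [cite: Atiyah1966PowerOperations, §2] -/
theorem psi_two_psi_three_kc_comm {M : Matrix ι ι R} (hM : IsIdempotentElem M) :
    psi R 2 (psi R 3 (kc M)) = psi R 3 (psi R 2 (kc M)) := by
  rw [psi_two_psi_three_kc hM, psi_three_psi_two_kc hM]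
  obtain ⟨τ, hτ⟩ := IsAdamsPrime.exists_inverter 3
  have hflip : ∀ e m : ℤ, Hcls 3 2 e m M = Hcls 2 3 m e M := fun e m ↦ Hcls_flip three_ne_zero two_ne_zero e m hM
  have hper : ∀ e : ℤ, Hcls 2 3 e 2 M = Hcls 2 3 e 1 M := by
    intro e
    have h1 : Hcls 2 3 e (-2) M = Hcls 2 3 e 2 M := Hcls_neg_right two_ne_zero three_ne_zero hτ e 2 hM
    rw [← h1, Hcls, Hcls, show (-2 : ℤ) = 1 + (3 : ℕ) * (-1) by norm_num, eig_add_natCast_mul]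
  simp only [hflip, hper]
  abel

/-- **The Adams operations commute: `ψ² ∘ ψ³ = ψ³ ∘ ψ²` on `K₀(R)`** (both equal `ψ⁶`; proved here
through the joint eigen-decomposition of the commuting outer/inner cyclic actions on `M^{⊗6}` and
the flip/reflection symmetries). [cite: Atiyah1966PowerOperations, §2] -/
theorem psi_two_comp_psi_three : (psi R 2).comp (psi R 3) = (psi R 3).comp (psi R 2) := by
  apply KZero.hom_ext
  intro p
  rw [AddMonoidHom.comp_apply, AddMonoidHom.comp_apply, ← kc_mat p]
  exact psi_two_psi_three_kc_comm p.isIdempotentElem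

/-- Adams operations via cyclic power operations (Atiyah 1966 §2). [folklore] -/
theorem psi_two_psi_three (x : KZero R) : psi R 2 (psi R 3 x) = psi R 3 (psi R 2 x) := by
  have h := congrArg (fun f : KZero R →+ KZero R ↦ f x) (psi_two_comp_psi_three (R := R))
  simpa using h

end Commute

end Literature.RingTheory.KTheory

end
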